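import Mathlib
import Summits.ResolutionOfSingularities.ResolutionOfSingularities.Theorems.RadicialJungCleanModelsCleanLU3CompositePersistPrelims
import HarnessLib

/-!
# Route `RadicialJung`, crux `CleanModels` (stmt-15917), stub `stub_cleanLU3DefectNonDiscrete`, sub-line (C-div): STUB `stub_persistCases`
# (workfile `Lines/Sketch_Cdiv_assembly.lean` v3 §PersistV3, registered shape :185)

Lead `res-B-lead-1` g5.  OURS; nothing here proves resolution in characteristic `p`.

**Tracked persistence of loose cleanness under ONE quadratic transform `S ⊂ S'` along `Ō` in dimension two, with DECOUPLED regular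
systems of parameters.**  Input: coefficients `c_j` with `c_j · d · x^α y^β ∈ S` for an r.s.p. `(x, y)` of `S`; the representative
`G = Σ c_j^p ū^j` in form (1) `ε x₁^a y₁^b` in its own r.s.p. `(x₁, y₁)` (exponents `0` or prime to `p`, not both `0`) or in form (2)
(a unit, residually not a `p`-th power); the first-order facts E1/E2 of the step as hypotheses.  Output: `c' = c` or `c / x₁^{(a+b)/p}`,
integrality w.r.t. the r.s.p. `(σ, y')` of `S'` where `σ ∈ {x, y}` is the generator of minimal value (`y' = τ/σ` at the origin of the
chart, exponents `(α+β(+m), β)`; any completion off it, exponents `(α+β(+m), 0)`), and form (1) in `(x₁, y₁/x₁)` or `(x₁, f)`, or form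
(2)/(3) decided by E1 (unit `ε (y₁/x₁)^b` after rescaling, `p ∣ a+b`) resp. E2 (form (2) input).

* `persist_integrality` / `persist_integrality_rescale` — the integrality half;
* `persist_form_one` — the four sub-cases of a form-(1) input;
* `stub_persistCases` — the registered statement.
-/

noncomputable section

set_option linter.dupNamespace false -- mandated namespace of this single-conjunct summit

open IsLocalRing
open Literature.AlgebraicGeometry.Resolution

namespace Summit.ResolutionOfSingularities.ResolutionOfSingularities.Theorems.RadicialJung.CleanModels

variable {κ : Type} [Field κ]

section Persist

variable {Ō : ValuationSubring κ} {S S' : Subring κ}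

/-- Rescaling a family of coefficients by a power: `Σ (c_j / e)^p ū^j = (Σ c_j^p ū^j) / e^p`. [folklore] -/
theorem sum_div_pow_eq {p : ℕ} (c : Fin p → κ) (ū e : κ) :
    (∑ j : Fin p, (c j / e) ^ p * ū ^ (j : ℕ)) = (∑ j : Fin p, c j ^ p * ū ^ (j : ℕ)) / e ^ p := by
  rw [Finset.sum_div]
  refine Finset.sum_congr rfl fun j _ => ?_
  rw [div_pow, div_mul_eq_mul_div]

/-- Non-triviality of the coefficient family survives division by a nonzero scalar. [folklore] -/
theorem exists_ne_zero_div {p : ℕ} {c : Fin p → κ} (hc : ∃ j : Fin p, (j : ℕ) ≠ 0 ∧ c j ≠ 0) {e : κ} (he : e ≠ 0) :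
    ∃ j : Fin p, (j : ℕ) ≠ 0 ∧ c j / e ≠ 0 := by
  obtain ⟨j, hj, hcj⟩ := hc
  exact ⟨j, hj, div_ne_zero hcj he⟩

/-- A generator of minimal value is nonzero (the transform datum has a nonzero generator of minimal value). [folklore] -/
theorem ne_zero_of_max [IsLocalRing S] (hqt : IsQuadraticTransformAlong Ō S S') {σ : S}
    (hmax : ∀ z ∈ maximalIdeal S, Ō.valuation (z : κ) ≤ Ō.valuation (σ : κ)) : (σ : κ) ≠ 0 := by
  intro h
  obtain ⟨_, x, hxm, hx0, -, -⟩ := hqt.exists_eq_locAtCentre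
  have h1 := hmax x hxm
  rw [h, map_zero, le_zero_iff, map_eq_zero] at h1
  exact hx0 (Subtype.ext h1)

/-- Two generators of minimal value differ by a unit of `S'`: `σ/x₁ ∈ S'`. [folklore] -/
theorem div_gens_mem_qt [IsLocalRing S] (hqt : IsQuadraticTransformAlong Ō S S')
    (σ τ : S) (hm : maximalIdeal S = Ideal.span {σ, τ})
    (hmax : ∀ z ∈ maximalIdeal S, Ō.valuation (z : κ) ≤ Ō.valuation (σ : κ))
    {x₁ : S} (hx₁ : x₁ ∈ maximalIdeal S) (hmax₁ : ∀ z ∈ maximalIdeal S, Ō.valuation (z : κ) ≤ Ō.valuation (x₁ : κ)) :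
    ((σ : S) : κ) / (x₁ : κ) ∈ S' := by
  have hσm : σ ∈ maximalIdeal S := by rw [hm]; exact Ideal.subset_span (by simp)
  have h1 : ((x₁ : S) : κ) / (σ : κ) ∈ S' := div_mem_qt hqt σ τ hm hmax hx₁
  have hσ0 : (σ : κ) ≠ 0 := ne_zero_of_max hqt hmax
  have hx0 : (x₁ : κ) ≠ 0 := ne_zero_of_max hqt hmax₁
  have hv : Ō.valuation (((x₁ : S) : κ) / (σ : κ)) = 1 := by
    rw [map_div₀, div_eq_one_iff_eq ((_root_.map_ne_zero _).mpr hσ0)]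
    exact le_antisymm (hmax x₁ hx₁) (hmax₁ σ hσm)
  have hu : IsUnit (⟨_, h1⟩ : S') := (isUnit_qt_iff hqt _).mpr hv
  rw [isUnit_subring_iff_inv_mem] at hu
  have e : (((x₁ : S) : κ) / (σ : κ))⁻¹ = ((σ : S) : κ) / (x₁ : κ) := by rw [inv_div]
  rw [← e]; exact hu.2

/-- **Integrality transfer** along the chart of the minimal-value generator `σ` of the integrality r.s.p. `(σ, τ)`: the same
coefficients are integral at `S'` w.r.t. an r.s.p. `(σ, y')` of `S'`, exponents `(α+β, β)` at the origin of the chart, `(α+β, 0)` off it.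
[folklore] -/
theorem persist_integrality [IsLocalRing S] (hqt : IsQuadraticTransformAlong Ō S S') (hdom : SubringDominates S Ō.toSubring)
    (σ τ : S) (hm : maximalIdeal S = Ideal.span {σ, τ})
    (hmax : ∀ z ∈ maximalIdeal S, Ō.valuation (z : κ) ≤ Ō.valuation (σ : κ))
    {p : ℕ} (c : Fin p → κ) (d : κ) (α β : ℕ)
    (hint : ∀ j : Fin p, c j * d * (σ : κ) ^ α * (τ : κ) ^ β ∈ S) :
    ∃ (y' : S'), (haveI := hqt.isLocalRing; maximalIdeal S') = Ideal.span {⟨(σ : κ), hqt.le σ.2⟩, y'} ∧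
      ∃ (α' β' : ℕ), ∀ j : Fin p, c j * d * (σ : κ) ^ α' * (y' : κ) ^ β' ∈ S' := by
  haveI := hqt.isLocalRing
  have hσ0 : (σ : κ) ≠ 0 := ne_zero_of_max hqt hmax
  set w : κ := ((τ : S) : κ) / (σ : κ) with hw
  have hwS' : w ∈ S' := ratio_mem_qt hqt σ τ hm hmax
  have hτ : ((τ : S) : κ) = (σ : κ) * w := by rw [hw, mul_div_cancel₀ _ hσ0]
  by_cases hlt : Ō.valuation w < 1
  · refine ⟨⟨w, hwS'⟩, maximalIdeal_qt_eq_span_of_lt hqt hdom σ τ hm hmax hlt, α + β, β, fun j => ?_⟩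
    have e : c j * d * (σ : κ) ^ (α + β) * w ^ β = c j * d * (σ : κ) ^ α * (τ : κ) ^ β := by
      rw [hτ]; ring
    rw [e]; exact hqt.le (hint j)
  · -- `w` is a unit of `S'`
    have hv1 : Ō.valuation w = 1 :=
      le_antisymm ((Ō.valuation_le_one_iff _).mpr (hqt.target_le hwS')) (not_lt.mp hlt)
    have hw0 : w ≠ 0 := ne_zero_of_valuation_eq_one hv1
    have hwu : IsUnit (⟨w, hwS'⟩ : S') := (isUnit_qt_iff hqt _).mpr hv1
    rw [isUnit_subring_iff_inv_mem] at hwu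
    obtain ⟨f, hf⟩ := exists_maximalIdeal_qt_eq_span hqt hdom σ τ hm hmax
    refine ⟨f, hf, α + β, 0, fun j => ?_⟩
    have e : c j * d * (σ : κ) ^ (α + β) * (f : κ) ^ 0 = (c j * d * (σ : κ) ^ α * (τ : κ) ^ β) * (w⁻¹) ^ β := by
      rw [hτ, pow_zero, mul_one, mul_pow, inv_pow, pow_add]
      field_simp
    rw [e]
    exact S'.mul_mem (hqt.le (hint j)) (S'.pow_mem hwu.2 β)

/-- **Integrality after rescaling** the coefficients by `x₁^m`, `x₁` another generator of minimal value: the exponent of `σ` grows by `m`.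
[folklore] -/
theorem persist_integrality_rescale [IsLocalRing S] (hqt : IsQuadraticTransformAlong Ō S S')
    (σ τ : S) (hm : maximalIdeal S = Ideal.span {σ, τ})
    (hmax : ∀ z ∈ maximalIdeal S, Ō.valuation (z : κ) ≤ Ō.valuation (σ : κ))
    {x₁ : S} (hx₁ : x₁ ∈ maximalIdeal S) (hmax₁ : ∀ z ∈ maximalIdeal S, Ō.valuation (z : κ) ≤ Ō.valuation (x₁ : κ))
    {p : ℕ} (c : Fin p → κ) (d : κ) (y' : S') (α' β' : ℕ) (m : ℕ)
    (hint : ∀ j : Fin p, c j * d * (σ : κ) ^ α' * (y' : κ) ^ β' ∈ S') :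
    ∀ j : Fin p, c j / (x₁ : κ) ^ m * d * (σ : κ) ^ (α' + m) * (y' : κ) ^ β' ∈ S' := by
  intro j
  have hx0 : (x₁ : κ) ≠ 0 := ne_zero_of_max hqt hmax₁
  have hq : ((σ : S) : κ) / (x₁ : κ) ∈ S' := div_gens_mem_qt hqt σ τ hm hmax hx₁ hmax₁
  have e : c j / (x₁ : κ) ^ m * d * (σ : κ) ^ (α' + m) * (y' : κ) ^ β' =
      (c j * d * (σ : κ) ^ α' * (y' : κ) ^ β') * (((σ : S) : κ) / (x₁ : κ)) ^ m := by
    rw [div_pow, pow_add]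
    field_simp
  rw [e]
  exact S'.mul_mem (hint j) (S'.pow_mem hq m)

/-- Exponent bookkeeping: if `p ∣ a + b` for a loosely clean pair of exponents `(a, b) ≠ (0, 0)`, `p ∤ a` or `a = 0`, `p ∤ b` or `b = 0`,
then `b ≠ 0` and `p ∤ b` (and symmetrically for `a`). [folklore] -/
theorem not_dvd_of_dvd_add {p a b : ℕ} (hab : a ≠ 0 ∨ b ≠ 0) (ha : a = 0 ∨ ¬ p ∣ a) (hb : b = 0 ∨ ¬ p ∣ b)
    (hpab : p ∣ a + b) : b ≠ 0 ∧ ¬ p ∣ b := by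
  rcases hb with rfl | hb
  · rw [add_zero] at hpab
    rcases ha with rfl | ha
    · simp at hab
    · exact absurd hpab ha
  · refine ⟨?_, hb⟩
    rintro rfl
    exact hb (dvd_zero p)

/-- **The decision «form (3) or form (2)»** for a unit `θ` of `S'` which is a `p`-th power at most to first order. [folklore] -/
theorem form_three_or_two [IsLocalRing S'] {p : ℕ} (θ : S') (hθ : IsUnit θ)
    (hfirst : ∀ γ : S', θ - γ ^ p ∉ maximalIdeal S' ^ 2) (G : κ) (hG : G = (θ : κ)) :
    (∃ u : S', IsUnit u ∧ G = (u : κ) ∧ ∀ c'' : S', u - c'' ^ p ∉ maximalIdeal S') ∨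
      (∃ s c'' : S', G = (s : κ) ∧ s - c'' ^ p ∈ maximalIdeal S' ∧ s - c'' ^ p ∉ maximalIdeal S' ^ 2) := by
  by_cases h : ∃ γ : S', θ - γ ^ p ∈ maximalIdeal S'
  · obtain ⟨γ, hγ⟩ := h
    exact Or.inr ⟨θ, γ, hG, hγ, hfirst γ⟩
  · push Not at h
    exact Or.inl ⟨θ, hθ, hG, h⟩

/-- **Form (1) persists (decoupled)** when the clean-form r.s.p. `(x₁, y₁)` has `x₁` of minimal value — the four sub-cases
origin/non-origin × `p ∤ a+b` / `p ∣ a+b` of workfile v3 §PersistV3, with E1 as hypothesis; the coefficient family is either kept or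
divided by `x₁^{(a+b)/p}`. [folklore] -/
theorem persist_form_one {p : ℕ} [Fact p.Prime] [IsRegularLocalRing S] [IsRegularLocalRing S']
    (hqt : IsQuadraticTransformAlong Ō S S') (hdom : SubringDominates S Ō.toSubring)
    (hE1 : ∀ (x₁ y₁ : S), maximalIdeal S = Ideal.span {x₁, y₁} → ∀ (ε : S), IsUnit ε → ∀ (b : ℕ), ¬ p ∣ b →
      ∀ (θ : S'), IsUnit θ → (θ : κ) * (x₁ : κ) ^ b = (ε : κ) * (y₁ : κ) ^ b →
      ∀ γ : S', θ - γ ^ p ∉ maximalIdeal S' ^ 2)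
    (ū : κ) (c : Fin p → κ)
    (x₁ y₁ : S) (hm₁ : maximalIdeal S = Ideal.span {x₁, y₁})
    (hmax₁ : ∀ z ∈ maximalIdeal S, Ō.valuation (z : κ) ≤ Ō.valuation (x₁ : κ))
    (a b : ℕ) (ε : S) (hε : IsUnit ε) (hab : a ≠ 0 ∨ b ≠ 0) (ha : a = 0 ∨ ¬ p ∣ a) (hb : b = 0 ∨ ¬ p ∣ b)
    (hG : (∑ j : Fin p, c j ^ p * ū ^ (j : ℕ)) = (ε : κ) * (x₁ : κ) ^ a * (y₁ : κ) ^ b) :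
    ∃ m : ℕ, (m = 0 ∨ p * m = a + b) ∧
    ((∃ (x₁' y₁' : S'), maximalIdeal S' = Ideal.span {x₁', y₁'} ∧ ∃ (a' b' : ℕ) (ε' : S'), IsUnit ε' ∧ (a' ≠ 0 ∨ b' ≠ 0) ∧
        (a' = 0 ∨ ¬ p ∣ a') ∧ (b' = 0 ∨ ¬ p ∣ b') ∧
        (∑ j : Fin p, (c j / (x₁ : κ) ^ m) ^ p * ū ^ (j : ℕ)) = (ε' : κ) * (x₁' : κ) ^ a' * (y₁' : κ) ^ b') ∨
      (∃ u : S', IsUnit u ∧ (∑ j : Fin p, (c j / (x₁ : κ) ^ m) ^ p * ū ^ (j : ℕ)) = (u : κ) ∧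
        ∀ c'' : S', u - c'' ^ p ∉ maximalIdeal S') ∨
      (∃ s c'' : S', (∑ j : Fin p, (c j / (x₁ : κ) ^ m) ^ p * ū ^ (j : ℕ)) = (s : κ) ∧ s - c'' ^ p ∈ maximalIdeal S' ∧
        s - c'' ^ p ∉ maximalIdeal S' ^ 2)) := by
  have hx0 : (x₁ : κ) ≠ 0 := ne_zero_of_max hqt hmax₁
  set w : κ := ((y₁ : S) : κ) / (x₁ : κ) with hw
  have hwS' : w ∈ S' := ratio_mem_qt hqt x₁ y₁ hm₁ hmax₁
  have hy₁ : ((y₁ : S) : κ) = (x₁ : κ) * w := by rw [hw, mul_div_cancel₀ _ hx0]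
  set x₁' : S' := ⟨(x₁ : κ), hqt.le x₁.2⟩ with hx₁'
  set w' : S' := ⟨w, hwS'⟩ with hw'
  set ε' : S' := ⟨(ε : κ), hqt.le ε.2⟩ with hε'
  have hε'u : IsUnit ε' := isUnit_qt_of_isUnit hqt hε
  -- the representative in the chart: `G = ε x₁^{a+b} w^b`
  have hG' : (∑ j : Fin p, c j ^ p * ū ^ (j : ℕ)) = (ε : κ) * (x₁ : κ) ^ (a + b) * w ^ b := by
    rw [hG, hy₁]; ring
  by_cases hpab : p ∣ a + b
  · -- rescale by `x₁^m`, `p m = a + b`; then `b ≠ 0`, `p ∤ b`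
    obtain ⟨m, hm⟩ := hpab
    obtain ⟨hb0, hpb⟩ := not_dvd_of_dvd_add hab ha hb ⟨m, hm⟩
    have hGm : (∑ j : Fin p, (c j / (x₁ : κ) ^ m) ^ p * ū ^ (j : ℕ)) = (ε : κ) * w ^ b := by
      rw [sum_div_pow_eq, hG', ← pow_mul, mul_comm m p, ← hm]
      field_simp
    refine ⟨m, Or.inr hm.symm, ?_⟩
    by_cases hlt : Ō.valuation w < 1
    · -- origin of the chart: form (1) in `(x₁, w)` with exponents `(0, b)`
      refine Or.inl ⟨x₁', w', maximalIdeal_qt_eq_span_of_lt hqt hdom x₁ y₁ hm₁ hmax₁ hlt, 0, b, ε', hε'u, Or.inr hb0,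
        Or.inl rfl, Or.inr hpb, ?_⟩
      rw [hGm, pow_zero, mul_one]
    · -- off the origin: `θ = ε w^b` is a unit, E1 decides form (3) / (2)
      have hv1 : Ō.valuation w = 1 :=
        le_antisymm ((Ō.valuation_le_one_iff _).mpr (hqt.target_le hwS')) (not_lt.mp hlt)
      have hwu : IsUnit w' := (isUnit_qt_iff hqt _).mpr hv1
      set θ : S' := ε' * w' ^ b with hθ
      have hθu : IsUnit θ := hε'u.mul (hwu.pow b)
      have hθeq : (θ : κ) * (x₁ : κ) ^ b = (ε : κ) * (y₁ : κ) ^ b := by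
        rw [hθ, hy₁]; push_cast; rw [hw']; ring
      have hfirst := hE1 x₁ y₁ hm₁ ε hε b hpb θ hθu hθeq
      exact Or.inr (form_three_or_two θ hθu hfirst _ (by rw [hGm, hθ]; push_cast; rw [hw']))
  · refine ⟨0, Or.inl rfl, ?_⟩
    have hG0 : (∑ j : Fin p, (c j / (x₁ : κ) ^ 0) ^ p * ū ^ (j : ℕ)) = (ε : κ) * (x₁ : κ) ^ (a + b) * w ^ b := by
      rw [← hG']; simp
    have hab' : a + b ≠ 0 := by omega
    by_cases hlt : Ō.valuation w < 1
    · -- origin: form (1) in `(x₁, w)` with exponents `(a+b, b)`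
      exact Or.inl ⟨x₁', w', maximalIdeal_qt_eq_span_of_lt hqt hdom x₁ y₁ hm₁ hmax₁ hlt, a + b, b, ε', hε'u, Or.inl hab',
        Or.inr hpab, hb, by rw [hG0]⟩
    · -- off the origin: form (1) in `(x₁, f)` with exponents `(a+b, 0)`, unit `ε w^b`
      have hv1 : Ō.valuation w = 1 :=
        le_antisymm ((Ō.valuation_le_one_iff _).mpr (hqt.target_le hwS')) (not_lt.mp hlt)
      have hwu : IsUnit w' := (isUnit_qt_iff hqt _).mpr hv1
      obtain ⟨f, hf⟩ := exists_maximalIdeal_qt_eq_span hqt hdom x₁ y₁ hm₁ hmax₁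
      refine Or.inl ⟨x₁', f, hf, a + b, 0, ε' * w' ^ b, hε'u.mul (hwu.pow b), Or.inl hab', Or.inr hpab, Or.inl rfl, ?_⟩
      rw [hG0]; push_cast; rw [hw']; ring

/-- **STUB CASES** (workfile `Lines/Sketch_Cdiv_assembly.lean` v3 :185, registered shape): tracked persistence of loose cleanness under
one quadratic transform in dimension two with DECOUPLED regular systems of parameters — integrality of `c_j · d` in an r.s.p. `(x, y)`
of `S`, the clean form (1) in its own r.s.p. `(x₁, y₁)` (or form (2)), E1/E2 as hypotheses; output: a non-trivial `c'` (`= c` or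
`c / x₁^{(a+b)/p}`), an integrality r.s.p. `(x', y')` of `S'` (the chart of the minimal-value generator of `(x, y)`) with exponents, and form
(1) in some r.s.p. of `S'`, or (2), or (3).  Proof = `persist_integrality` (+ `_rescale`) ∧ `persist_form_one` / E2. [folklore] -/
theorem stub_persistCases :
    ∀ (p : ℕ) [Fact p.Prime] (κ : Type) [Field κ] [CharP κ p]
    (Ō : ValuationSubring κ) (S S' : Subring κ) [IsRegularLocalRing S] [IsRegularLocalRing S'],
    ringKrullDim S = 2 → ringKrullDim S' = 2 → IsLocalRingOf S → IsQuadraticTransformAlong Ō S S' →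
    SubringDominates S Ō.toSubring →
    (∀ (x₁ y₁ : S), maximalIdeal S = Ideal.span {x₁, y₁} → ∀ (ε : S), IsUnit ε → ∀ (b : ℕ), ¬ p ∣ b →
      ∀ (θ : S'), IsUnit θ → (θ : κ) * (x₁ : κ) ^ b = (ε : κ) * (y₁ : κ) ^ b →
      ∀ γ : S', θ - γ ^ p ∉ maximalIdeal S' ^ 2) →
    (∀ (ε : S), (∀ b : S, ε - b ^ p ∉ maximalIdeal S) → ∀ (θ : S'), (θ : κ) = (ε : κ) →
      ∀ γ : S', θ - γ ^ p ∉ maximalIdeal S' ^ 2) →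
    ∀ (ū d : κ), d ∈ S → d ≠ 0 →
    ∀ (c : Fin p → κ), (∃ j : Fin p, (j : ℕ) ≠ 0 ∧ c j ≠ 0) →
    ∀ (x y : S), maximalIdeal S = Ideal.span {x, y} →
    ∀ (α β : ℕ), (∀ j : Fin p, c j * d * (x : κ) ^ α * (y : κ) ^ β ∈ S) →
    ((∃ (x₁ y₁ : S), maximalIdeal S = Ideal.span {x₁, y₁} ∧ ∃ (a b : ℕ) (ε : S), IsUnit ε ∧ (a ≠ 0 ∨ b ≠ 0) ∧
        (a = 0 ∨ ¬ p ∣ a) ∧ (b = 0 ∨ ¬ p ∣ b) ∧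
        (∑ j : Fin p, c j ^ p * ū ^ (j : ℕ)) = (ε : κ) * (x₁ : κ) ^ a * (y₁ : κ) ^ b) ∨
      (∃ u : S, IsUnit u ∧ (∑ j : Fin p, c j ^ p * ū ^ (j : ℕ)) = (u : κ) ∧ ∀ c' : S, u - c' ^ p ∉ maximalIdeal S)) →
    ∃ (c' : Fin p → κ), (∃ j : Fin p, (j : ℕ) ≠ 0 ∧ c' j ≠ 0) ∧
    ∃ (x' y' : S'), maximalIdeal S' = Ideal.span {x', y'} ∧
    ∃ (α' β' : ℕ), (∀ j : Fin p, c' j * d * (x' : κ) ^ α' * (y' : κ) ^ β' ∈ S') ∧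
    ((∃ (x₁ y₁ : S'), maximalIdeal S' = Ideal.span {x₁, y₁} ∧ ∃ (a b : ℕ) (ε : S'), IsUnit ε ∧ (a ≠ 0 ∨ b ≠ 0) ∧
        (a = 0 ∨ ¬ p ∣ a) ∧ (b = 0 ∨ ¬ p ∣ b) ∧
        (∑ j : Fin p, c' j ^ p * ū ^ (j : ℕ)) = (ε : κ) * (x₁ : κ) ^ a * (y₁ : κ) ^ b) ∨
      (∃ u : S', IsUnit u ∧ (∑ j : Fin p, c' j ^ p * ū ^ (j : ℕ)) = (u : κ) ∧ ∀ c'' : S', u - c'' ^ p ∉ maximalIdeal S') ∨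
      (∃ s c'' : S', (∑ j : Fin p, c' j ^ p * ū ^ (j : ℕ)) = (s : κ) ∧ s - c'' ^ p ∈ maximalIdeal S' ∧
        s - c'' ^ p ∉ maximalIdeal S' ^ 2)) := by
  intro p _ κ _ _ Ō S S' _ _ _ _ _ hqt hdom hE1 hE2 ū d _ _ c hc x y hm α β hint hform
  -- integrality data in the chart of the minimal-value generator `σ ∈ {x, y}`
  obtain ⟨σ, τ, hmσ, hmaxσ, hintσ⟩ : ∃ σ τ : S, maximalIdeal S = Ideal.span {σ, τ} ∧
      (∀ z ∈ maximalIdeal S, Ō.valuation (z : κ) ≤ Ō.valuation (σ : κ)) ∧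
      ∃ (α₀ β₀ : ℕ), ∀ j : Fin p, c j * d * (σ : κ) ^ α₀ * (τ : κ) ^ β₀ ∈ S := by
    rcases exists_max_valuation_gen Ō S hdom.1 x y hm with hx | hy
    · exact ⟨x, y, hm, hx, α, β, hint⟩
    · refine ⟨y, x, by rw [hm, Set.pair_comm], hy, β, α, fun j => ?_⟩
      have e : c j * d * (y : κ) ^ β * (x : κ) ^ α = c j * d * (x : κ) ^ α * (y : κ) ^ β := by ring
      rw [e]; exact hint j
  obtain ⟨α₀, β₀, hint₀⟩ := hintσ
  obtain ⟨y', hmy', α', β', hint'⟩ := persist_integrality hqt hdom σ τ hmσ hmaxσ c d α₀ β₀ hint₀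
  have hσm : σ ∈ maximalIdeal S := by rw [hmσ]; exact Ideal.subset_span (by simp)
  rcases hform with ⟨x₁, y₁, hm₁, a, b, ε, hε, hab, ha, hb, hG⟩ | ⟨u, hu, hG, hres⟩
  · -- form (1): put the minimal-value generator of `(x₁, y₁)` first
    obtain ⟨x₁, y₁, hm₁, a, b, hab, ha, hb, hG, hmax₁⟩ : ∃ (x₁ y₁ : S), maximalIdeal S = Ideal.span {x₁, y₁} ∧ ∃ (a b : ℕ),
        (a ≠ 0 ∨ b ≠ 0) ∧ (a = 0 ∨ ¬ p ∣ a) ∧ (b = 0 ∨ ¬ p ∣ b) ∧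
        (∑ j : Fin p, c j ^ p * ū ^ (j : ℕ)) = (ε : κ) * (x₁ : κ) ^ a * (y₁ : κ) ^ b ∧
        (∀ z ∈ maximalIdeal S, Ō.valuation (z : κ) ≤ Ō.valuation (x₁ : κ)) := by
      rcases exists_max_valuation_gen Ō S hdom.1 x₁ y₁ hm₁ with h | h
      · exact ⟨x₁, y₁, hm₁, a, b, hab, ha, hb, hG, h⟩
      · exact ⟨y₁, x₁, by rw [hm₁, Set.pair_comm], b, a, hab.symm, hb, ha, by rw [hG]; ring, h⟩
    have hx₁m : x₁ ∈ maximalIdeal S := by rw [hm₁]; exact Ideal.subset_span (by simp)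
    have hx0 : (x₁ : κ) ≠ 0 := ne_zero_of_max hqt hmax₁
    obtain ⟨m, -, hout⟩ := persist_form_one hqt hdom hE1 ū c x₁ y₁ hm₁ hmax₁ a b ε hε hab ha hb hG
    refine ⟨fun j => c j / (x₁ : κ) ^ m, exists_ne_zero_div hc (pow_ne_zero _ hx0), ⟨(σ : κ), hqt.le σ.2⟩, y', hmy',
      α' + m, β', persist_integrality_rescale hqt σ τ hmσ hmaxσ hx₁m hmax₁ c d y' α' β' m hint', hout⟩
  · -- form (2): keep `c`; E2 decides form (3) / (2) upstairs
    haveI := hqt.isLocalRing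
    set θ : S' := ⟨(u : κ), hqt.le u.2⟩ with hθ
    have hθu : IsUnit θ := isUnit_qt_of_isUnit hqt hu
    have hfirst := hE2 u hres θ rfl
    refine ⟨c, hc, ⟨(σ : κ), hqt.le σ.2⟩, y', hmy', α', β', hint', Or.inr (form_three_or_two θ hθu hfirst _ hG)⟩

end Persist

end Summit.ResolutionOfSingularities.ResolutionOfSingularities.Theorems.RadicialJung.CleanModels

end
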